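import Mathlib
import Literature.NumberTheory.LFunctions.ZetaScrewNonArchSign

/-!
# Suzuki, *On variants of Chebyshev's conjecture* — Theorem 1

M. Suzuki, Ramanujan J. 68 (2025), art. 95 = arXiv:2411.07436, Theorem 1 (p. 2 of the arXiv text):
with `ψ_{1/2}(x) = ∑_{n ≤ x} Λ(n) n^{-1/2}` one has
`∫₀ˣ (ψ_{1/2}(y) − 2√y) dy/y = ∑_{n ≤ x} Λ(n) n^{-1/2} log(x/n) − 4√x`, and the following are
equivalent: (i) RH; (ii) there is `x₀ ≥ 2` with `∑_{n ≤ x} Λ(n) n^{-1/2} log(x/n) − 4√x ≤ 0` for all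
`x ≥ x₀`; (iii) `lim_{x→∞} [∑_{n ≤ x} Λ(n) n^{-1/2}(1 − log n/log x) − 4√x/log x] = −(ζ'/ζ)(1/2)`.
Vendored here: (i) ⟺ (ii) as a named fact (no `_holds`: the proof uses the explicit formula for
`ψ_{1/2}` and a Landau-type theorem for Laplace transforms of non-negative functions, §2.4 Prop. 1
there). In the language of Suzuki's screw function `g_ζ = −Ψ` (tree: `zetaScrew`,
`Literature/NumberTheory/LFunctions/ZetaScrew.lean`) the sum in (ii) is the non-archimedean part
`g₀(log x) = ∑_{n ≤ x} Λ(n) n^{-1/2} log(x/n) − 4(√x + 1/√x − 2)` up to the bounded term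
`4(1/√x − 2)` (display (1.7) and Corollary 1 there: RH ⟺ `−g₀(t) ≥ 0` for all `t ≥ t₀`).
Nearest print to route `RiemannHypothesis/IntegerScrew`'s crux `DiscreteLandau`
(`Ψ(log m) ≥ 0` at the INTEGERS ⇒ RH), which samples the criterion only at `x ∈ ℕ`.
-/

namespace Literature.NumberTheory.LFunctions

/-- The integrated half-line Chebyshev bias
`∫₀ˣ (ψ_{1/2}(y) − 2√y) dy/y = ∑_{1 ≤ n ≤ ⌊x⌋} Λ(n) n^{-1/2} log(x/n) − 4√x`
(Suzuki 2025, display (1.5)). [cite: Suzuki2024, (1.5)] -/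
noncomputable def chebyshevHalfLineBias (x : ℝ) : ℝ :=
  (∑ n ∈ Finset.Icc 1 ⌊x⌋₊,
      (ArithmeticFunction.vonMangoldt n : ℝ) / Real.sqrt n * Real.log (x / n)) -
    4 * Real.sqrt x

/-- **Suzuki 2025, Theorem 1, (i) ⟺ (ii)** (Ramanujan J. 68:95 = arXiv:2411.07436, Thm. 1, p. 2):
"The following statements are equivalent: • The RH holds. • There exists an `x₀ ≥ 2` such that
`∑_{n ≤ x} Λ(n) n^{-1/2} log(x/n) − 4√x ≤ 0` holds for all `x ≥ x₀`." A one-signed (Landau-type)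
RH criterion on the critical line; grounds the nearest-print comparison for
`Summit.RiemannHypothesis.RiemannHypothesis.Theses.IntegerScrew.DiscreteLandau` (which assumes the
sign condition only at integer `x`). Users take `(h : Suzuki2024_thm1)`. [cite: Suzuki2024, Thm 1] -/
def Suzuki2024_thm1 : Prop :=
  RiemannHypothesis ↔ ∃ x₀ : ℝ, 2 ≤ x₀ ∧ ∀ x : ℝ, x₀ ≤ x → chebyshevHalfLineBias x ≤ 0

/-- Unfolding lemma: the criterion of `Suzuki2024_thm1` written out. [cite: Suzuki2024, Thm 1] -/
theorem Suzuki2024_thm1_iff :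
    Suzuki2024_thm1 ↔
      (RiemannHypothesis ↔ ∃ x₀ : ℝ, 2 ≤ x₀ ∧ ∀ x : ℝ, x₀ ≤ x →
        (∑ n ∈ Finset.Icc 1 ⌊x⌋₊,
            (ArithmeticFunction.vonMangoldt n : ℝ) / Real.sqrt n * Real.log (x / n)) -
          4 * Real.sqrt x ≤ 0) :=
  Iff.rfl

/-- Sanity value: below `x = 2` no prime power contributes, so the bias is `−4√x`
(e.g. at `x = 1`). [cite: Suzuki2024, (1.5)] -/
theorem chebyshevHalfLineBias_one : chebyshevHalfLineBias 1 = -4 := by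
  simp [chebyshevHalfLineBias]

/-- **DISCHARGE of `Suzuki2024_thm1`** (Suzuki, Ramanujan J. 68:95 (2025) = arXiv:2411.07436, Thm. 1,
(i) ⟺ (ii)): the tree proves this equivalence as `Suzuki2025_thm1` in
`Literature/NumberTheory/LFunctions/ZetaScrewNonArchSign.lean` ((ii) ⇒ (i) by Landau's theorem on the
Laplace transform (3.4); (i) ⇒ (ii) from `Ψ ≥ 0` under RH and (1.9)); the two statements agree
verbatim (`chebyshevHalfLineBias x` is the printed left-hand side of (ii)). RH-EQUIVALENT criterion;
no new fact. [cite: Suzuki2024, Thm 1] -/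
theorem Suzuki2024_thm1_holds : Suzuki2024_thm1 := by
  rw [Suzuki2024_thm1_iff]
  exact Suzuki2025_thm1

end Literature.NumberTheory.LFunctions
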